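import Literature.NumberTheory.Sieve.FGKMT2018DkBoxClasses
import Literature.NumberTheory.Sieve.SelbergSieveOneDim
import HarnessLib

/-!
# Maynard's Proposition 9.4: the class count for the coupled `(k+1)`-dimensional system

Source: J. Maynard, *Dense clusters of primes in subsets*, Compositio Math. 152 (2016) =
arXiv:1405.2593 [Maynard2016DenseClusters], proof of Proposition 9.4 pp. 25–26; the `k`-form model is
the proof of Proposition 9.1 p. 19 (display (9.1), «no contribution unless `(d_ie_i, d_je_j) = 1`»),
typed in `FGKMT2018DkBoxClasses` (`cross_coprime_or_empty`, `abs_card_dyadZ_pair_sub_le'`).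

In the proof of Prop. 9.4 the indicator of «`L₀(n)` prime, `> R₀`, coprime to `W`» is majorised by the
one-dimensional Selberg square `λ̃₁⁻² 1_{(L₀(n),W)=1} (∑_{d₀ ∣ L₀(n)} λ̃_{d₀})²` (`d₀ ∈ box₀ M R₀`,
`(d₀, M) = 1` with `W Δ_L ∣ M`), and multiplied by `w_n = 1_{(L_i(n),W)=1 ∀i}(∑_{d_i ∣ L_i(n)} λ_d)²`.
Expanding, one must count, for `d, e ∈ 𝒟_k(𝓛)` and `d₀, e₀ ∈ box₀`,
`#{n ∈ 𝒜(X) : (L_i(n), W) = 1, d_i, e_i ∣ L_i(n) ∀ i; (L₀(n), W) = 1, d₀, e₀ ∣ L₀(n)}`.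
This is the local class count `abs_card_dyadZ_localSystem_sub_le` for the EXTENDED family
`L⁺ = Fin.cons L₀ 𝓛` of `k+1` forms with moduli `([d₀,e₀], [d_i,e_i])` and the same `W`
(`abs_card_dyadZ_pairPlus_sub_le`: main term `#𝒜(X) φ_{ω⁺}(W)/(W [d₀,e₀] ∏[d_i,e_i])`, error `≤ φ_{ω⁺}(W)`),
valid for CROSS-COPRIME tuples; a tuple that is not cross-coprime has an empty class set
(`cross_coprime_or_empty_plus`, `card_pairPlus_filter_eq_zero`): for the new pairs `(0, i)` a common prime
`p ∣ d₀e₀`, `p ∣ d_ie_i` would give a common root of `L₀, L_i` mod `p`, so `p ∣ a₀b_i − a_ib₀ ∣ Δ_L ∣ M`,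
contradicting `(d₀e₀, M) = 1` (`joint_dvd_empty_plus`).

## References
* J. Maynard, *Dense clusters of primes in subsets*, Compositio Math. 152 (2016), proofs of Prop. 9.1
  p. 19 and Prop. 9.4 pp. 25–26 [Maynard2016DenseClusters].
* K. Ford, B. Green, S. Konyagin, J. Maynard, T. Tao, *Long gaps between primes*, JAMS 31 (2018),
  Thm 6 (iii) (7.14) p. 22 [FordGreenKonyaginMaynardTao2018].
-/

open Finset

namespace Literature.NumberTheory.Sieve.FGKMT2018

variable {k : ℕ}

/-- **«No contribution unless `(d₀e₀, d_ie_i) = 1`»** for the coupled system: with `Δ_L ∣ M` and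
`(d₀, M) = (e₀, M) = 1`, a prime dividing `d₀e₀` and `d_ie_i` admits no `n` with
`d_i, e_i ∣ L_i(n)` and `d₀, e₀ ∣ L₀(n)` (a common root of `L₀, L_i` mod `p` gives `p ∣ a₀b_i − a_ib₀ ∣ Δ_L`).
[cite: Maynard2016DenseClusters, proof of Prop. 9.4 p. 26 (the factor Δ_L/φ(Δ_L)), proof of Prop. 9.1 p. 19] -/
theorem joint_dvd_empty_plus {L : Fin k → ℤ × ℤ} (l₀ : ℤ × ℤ) {M : ℕ} (hΔ : discDelta L l₀ ∣ M)
    {d₀ e₀ : ℕ} (hd₀ : d₀.Coprime M) (he₀ : e₀.Coprime M) {d e : Fin k → ℕ}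
    {i : Fin k} {p : ℕ} (hp : p.Prime) (hp₀ : p ∣ d₀ * e₀) (hpi : p ∣ d i * e i) (n : ℤ)
    (hdn : ((d i : ℕ) : ℤ) ∣ formEval (L i) n) (hen : ((e i : ℕ) : ℤ) ∣ formEval (L i) n)
    (hd₀n : ((d₀ : ℕ) : ℤ) ∣ formEval l₀ n) (he₀n : ((e₀ : ℕ) : ℤ) ∣ formEval l₀ n) : False := by
  have hpLi : (p : ℤ) ∣ formEval (L i) n := by
    rcases hp.dvd_mul.1 hpi with h | h
    · exact (Int.natCast_dvd_natCast.2 h).trans hdn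
    · exact (Int.natCast_dvd_natCast.2 h).trans hen
  have hpL₀ : (p : ℤ) ∣ formEval l₀ n := by
    rcases hp.dvd_mul.1 hp₀ with h | h
    · exact (Int.natCast_dvd_natCast.2 h).trans hd₀n
    · exact (Int.natCast_dvd_natCast.2 h).trans he₀n
  have hres : (p : ℤ) ∣ l₀.1 * (L i).2 - (L i).1 * l₀.2 := by
    have e' : l₀.1 * (L i).2 - (L i).1 * l₀.2 = l₀.1 * formEval (L i) n - (L i).1 * formEval l₀ n := by
      unfold formEval; ring
    rw [e']
    exact dvd_sub (hpLi.mul_left _) (hpL₀.mul_left _)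
  have hpΔ : p ∣ discDelta L l₀ := by
    unfold discDelta
    exact dvd_mul_of_dvd_right ((Int.natCast_dvd.1 hres).trans
      (Finset.dvd_prod_of_mem (fun j => (l₀.1 * (L j).2 - (L j).1 * l₀.2).natAbs) (Finset.mem_univ i))) _
  have h1 : p ∣ Nat.gcd (d₀ * e₀) M := Nat.dvd_gcd hp₀ (hpΔ.trans hΔ)
  rw [Nat.Coprime.gcd_eq_one (Nat.Coprime.mul_left hd₀ he₀)] at h1
  exact hp.one_lt.ne' (Nat.dvd_one.1 h1)

/-- **The dichotomy for a coupled tuple** `d, e ∈ 𝒟_k(𝓛)`, `(d₀, M) = (e₀, M) = 1` (`𝓛` admissible,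
`Δ_L ∣ M`): either the `(k+1)`-tuple `([d₀,e₀]; [d_i,e_i])` is cross-coprime, or the joint divisibility
conditions have no solution `n`. [cite: Maynard2016DenseClusters, proof of Prop. 9.4 p. 26, proof of Prop. 9.1 p. 19] -/
theorem cross_coprime_or_empty_plus {L : Fin k → ℤ × ℤ} (hadm : FormsAdmissible L) {B : ℕ} {R : ℝ}
    {d e : Fin k → ℕ} (hd : d ∈ dkBox L B R) (he : e ∈ dkBox L B R) (l₀ : ℤ × ℤ) {M : ℕ}
    (hΔ : discDelta L l₀ ∣ M) {d₀ e₀ : ℕ} (hd₀ : d₀.Coprime M) (he₀ : e₀.Coprime M) :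
    ((Pairwise fun i j => (d i * e i).Coprime (d j * e j)) ∧ ∀ i, (d₀ * e₀).Coprime (d i * e i)) ∨
      ∀ n : ℤ, ¬ (((∀ ι, ((d ι : ℕ) : ℤ) ∣ formEval (L ι) n) ∧ ∀ ι, ((e ι : ℕ) : ℤ) ∣ formEval (L ι) n) ∧
        (((d₀ : ℕ) : ℤ) ∣ formEval l₀ n ∧ ((e₀ : ℕ) : ℤ) ∣ formEval l₀ n)) := by
  by_cases hP : (Pairwise fun i j => (d i * e i).Coprime (d j * e j)) ∧
      ∀ i, (d₀ * e₀).Coprime (d i * e i)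
  · exact Or.inl hP
  · refine Or.inr fun n hn => hP ⟨?_, fun i => ?_⟩
    · rcases cross_coprime_or_empty hadm hd he with h | h
      · exact h
      · exact absurd hn.1 (h n)
    · exact Nat.coprime_of_dvd fun p hp hp₀ hpi =>
        joint_dvd_empty_plus l₀ hΔ hd₀ he₀ hp hp₀ hpi n (hn.1.1 i) (hn.1.2 i) hn.2.1 hn.2.2

/-- `|a₀| ∣ Δ_L`. [cite: FordGreenKonyaginMaynardTao2018, Thm 6 (7.14) p. 22 (definition of Δ_L)] -/
theorem natAbs_fst_dvd_discDelta (L : Fin k → ℤ × ℤ) (l₀ : ℤ × ℤ) : l₀.1.natAbs ∣ discDelta L l₀ := by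
  unfold discDelta
  exact Dvd.intro _ rfl

/-- **The class count for a cross-coprime coupled tuple** (`𝓛` admissible, `d, e ∈ 𝒟_k(𝓛)`,
`d₀, e₀ ∈ box₀ M R₀` with `W ∣ M`, `Δ_L ∣ M`; `W = ∏_{p ≤ 2k², p ∤ B} p`):
`|#{n ∈ 𝒜(X) : (L_i(n),W)=1, d_i,e_i ∣ L_i(n) ∀i; (L₀(n),W)=1, d₀,e₀ ∣ L₀(n)} − #𝒜(X) φ_{ω⁺}(W)/(W [d₀,e₀] ∏[d_i,e_i])| ≤ φ_{ω⁺}(W)`,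
`φ_{ω⁺} = φ_ω` of the extended family `Fin.cons L₀ 𝓛`.
[cite: Maynard2016DenseClusters, proof of Prop. 9.4 p. 26 («we let r₀, s₀, … as before … counting n in residue classes»), (9.1) p. 19] -/
theorem abs_card_dyadZ_pairPlus_sub_le (X : ℝ) {L : Fin k → ℤ × ℤ} (hadm : FormsAdmissible L) {B : ℕ}
    {R : ℝ} {d e : Fin k → ℕ} (hd : d ∈ dkBox L B R) (he : e ∈ dkBox L B R) (l₀ : ℤ × ℤ) {M : ℕ}
    (hWM : wCut k B ∣ M) (hΔ : discDelta L l₀ ∣ M) {R₀ : ℝ} {d₀ e₀ : ℕ}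
    (hd₀ : d₀ ∈ SelbergBox.box₀ M R₀) (he₀ : e₀ ∈ SelbergBox.box₀ M R₀)
    (hcross : Pairwise fun i j => (d i * e i).Coprime (d j * e j))
    (hcross₀ : ∀ i, (d₀ * e₀).Coprime (d i * e i)) :
    |(#((dyadZ X).filter fun n : ℤ =>
          ((∀ i, Int.gcd (formEval (L i) n) (wCut k B) = 1) ∧
            (∀ i, ((d i : ℕ) : ℤ) ∣ formEval (L i) n) ∧ ∀ i, ((e i : ℕ) : ℤ) ∣ formEval (L i) n) ∧
          (Int.gcd (formEval l₀ n) (wCut k B) = 1 ∧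
            (((d₀ : ℕ) : ℤ) ∣ formEval l₀ n ∧ ((e₀ : ℕ) : ℤ) ∣ formEval l₀ n))) : ℝ) -
        (#(dyadZ X) : ℝ) * phiOmega (Fin.cons l₀ L : Fin (k + 1) → ℤ × ℤ) (wCut k B) /
          ((wCut k B : ℝ) * (((Nat.lcm d₀ e₀ : ℕ) : ℝ) * ∏ ι, ((Nat.lcm (d ι) (e ι) : ℕ) : ℝ)))|
      ≤ phiOmega (Fin.cons l₀ L : Fin (k + 1) → ℤ × ℤ) (wCut k B) := by
  classical
  set m : Fin (k + 1) → ℕ := Fin.cons (Nat.lcm d₀ e₀) (fun ι => Nat.lcm (d ι) (e ι)) with hm_def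
  have hm0 : m 0 = Nat.lcm d₀ e₀ := by simp [hm_def]
  have hms : ∀ ι : Fin k, m ι.succ = Nat.lcm (d ι) (e ι) := by intro ι; simp [hm_def]
  obtain ⟨⟨hd₀1, -⟩, -, hd₀M⟩ := SelbergBox.mem_box₀.1 hd₀
  obtain ⟨⟨he₀1, -⟩, -, he₀M⟩ := SelbergBox.mem_box₀.1 he₀
  have hm : ∀ i, 0 < m i := by
    intro i; rcases Fin.eq_zero_or_eq_succ i with rfl | ⟨ι, rfl⟩
    · rw [hm0]; exact Nat.lcm_pos hd₀1 he₀1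
    · rw [hms]; exact Nat.lcm_pos (one_le_of_mem_dkBox hd ι) (one_le_of_mem_dkBox he ι)
  have hmW : ∀ i, (m i).Coprime (wCut k B) := by
    intro i; rcases Fin.eq_zero_or_eq_succ i with rfl | ⟨ι, rfl⟩
    · rw [hm0]
      exact Nat.Coprime.coprime_dvd_left (Nat.lcm_dvd_mul _ _)
        (Nat.Coprime.coprime_dvd_right hWM (Nat.Coprime.mul_left hd₀M he₀M))
    · rw [hms]
      exact Nat.Coprime.coprime_dvd_left (Nat.lcm_dvd_mul _ _)
        (Nat.Coprime.mul_left (coprime_apply_wCut_of_mem_dkBox hd ι)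
          (coprime_apply_wCut_of_mem_dkBox he ι))
  have hmm : Pairwise fun i j => (m i).Coprime (m j) := by
    intro i j hij
    rcases Fin.eq_zero_or_eq_succ i with rfl | ⟨ι, rfl⟩ <;>
      rcases Fin.eq_zero_or_eq_succ j with rfl | ⟨κ, rfl⟩
    · exact absurd rfl hij
    · rw [hm0, hms]
      exact Nat.Coprime.coprime_dvd_left (Nat.lcm_dvd_mul _ _)
        (Nat.Coprime.coprime_dvd_right (Nat.lcm_dvd_mul _ _) (hcross₀ κ))
    · rw [hm0, hms]
      exact Nat.Coprime.coprime_dvd_left (Nat.lcm_dvd_mul _ _)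
        (Nat.Coprime.coprime_dvd_right (Nat.lcm_dvd_mul _ _) (hcross₀ ι).symm)
    · rw [hms, hms]
      have hικ : ι ≠ κ := fun h => hij (by rw [h])
      exact Nat.Coprime.coprime_dvd_left (Nat.lcm_dvd_mul _ _)
        (Nat.Coprime.coprime_dvd_right (Nat.lcm_dvd_mul _ _) (hcross hικ))
  have ham : ∀ i, Int.gcd ((Fin.cons l₀ L : Fin (k + 1) → ℤ × ℤ) i).1 (m i) = 1 := by
    intro i; rcases Fin.eq_zero_or_eq_succ i with rfl | ⟨ι, rfl⟩
    · rw [hm0, Fin.cons_zero, Int.gcd_eq_natAbs, Int.natAbs_natCast]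
      have ha : l₀.1.natAbs ∣ M := (natAbs_fst_dvd_discDelta L l₀).trans hΔ
      exact Nat.Coprime.coprime_dvd_right (Nat.lcm_dvd_mul _ _)
        (Nat.Coprime.coprime_dvd_left ha (Nat.Coprime.mul_left hd₀M he₀M).symm)
    · rw [hms, Fin.cons_succ]
      exact intGcd_fst_lcm_eq_one_of_mem_dkBox hadm hd he ι
  have h := abs_card_dyadZ_localSystem_sub_le X (Fin.cons l₀ L : Fin (k + 1) → ℤ × ℤ)
    (squarefree_wCut k B) m hm hmW hmm ham
  have hset : ((dyadZ X).filter fun n : ℤ =>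
      ((∀ i, Int.gcd (formEval (L i) n) (wCut k B) = 1) ∧
          (∀ i, ((d i : ℕ) : ℤ) ∣ formEval (L i) n) ∧ ∀ i, ((e i : ℕ) : ℤ) ∣ formEval (L i) n) ∧
        (Int.gcd (formEval l₀ n) (wCut k B) = 1 ∧
          (((d₀ : ℕ) : ℤ) ∣ formEval l₀ n ∧ ((e₀ : ℕ) : ℤ) ∣ formEval l₀ n))) =
      (dyadZ X).filter fun n : ℤ =>
        (∀ i, Int.gcd (formEval ((Fin.cons l₀ L : Fin (k + 1) → ℤ × ℤ) i) n) (wCut k B) = 1) ∧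
          ∀ i, ((m i : ℕ) : ℤ) ∣ formEval ((Fin.cons l₀ L : Fin (k + 1) → ℤ × ℤ) i) n := by
    refine Finset.filter_congr fun n _ => ?_
    rw [Fin.forall_fin_succ, Fin.forall_fin_succ, Fin.cons_zero, hm0, natCast_lcm_dvd_iff]
    simp only [Fin.cons_succ, hms, natCast_lcm_dvd_iff]
    constructor
    · rintro ⟨⟨h1, h2, h3⟩, h4, h5⟩
      exact ⟨⟨h4, h1⟩, h5, fun i => ⟨h2 i, h3 i⟩⟩
    · rintro ⟨⟨h4, h1⟩, h5, h23⟩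
      exact ⟨⟨h1, fun i => (h23 i).1, fun i => (h23 i).2⟩, h4, h5⟩
  have hprod : (∏ i, (m i : ℝ)) = ((Nat.lcm d₀ e₀ : ℕ) : ℝ) * ∏ ι, ((Nat.lcm (d ι) (e ι) : ℕ) : ℝ) := by
    rw [Fin.prod_univ_succ, hm0]
    simp only [hms]
  rw [hset, ← hprod]
  exact h

/-- A coupled tuple that is NOT cross-coprime has an EMPTY class set (count `0`).
[cite: Maynard2016DenseClusters, proof of Prop. 9.4 p. 26, proof of Prop. 9.1 p. 19 («no contribution unless …»)] -/
theorem card_pairPlus_filter_eq_zero (S : Finset ℤ) {L : Fin k → ℤ × ℤ} (hadm : FormsAdmissible L)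
    {B : ℕ} {R : ℝ} {d e : Fin k → ℕ} (hd : d ∈ dkBox L B R) (he : e ∈ dkBox L B R) (l₀ : ℤ × ℤ)
    {M : ℕ} (hΔ : discDelta L l₀ ∣ M) {R₀ : ℝ} {d₀ e₀ : ℕ}
    (hd₀ : d₀ ∈ SelbergBox.box₀ M R₀) (he₀ : e₀ ∈ SelbergBox.box₀ M R₀)
    (hcross : ¬ ((Pairwise fun i j => (d i * e i).Coprime (d j * e j)) ∧
      ∀ i, (d₀ * e₀).Coprime (d i * e i))) :
    #(S.filter fun n : ℤ =>
        ((∀ i, Int.gcd (formEval (L i) n) (wCut k B) = 1) ∧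
            (∀ i, ((d i : ℕ) : ℤ) ∣ formEval (L i) n) ∧ ∀ i, ((e i : ℕ) : ℤ) ∣ formEval (L i) n) ∧
          (Int.gcd (formEval l₀ n) (wCut k B) = 1 ∧
            (((d₀ : ℕ) : ℤ) ∣ formEval l₀ n ∧ ((e₀ : ℕ) : ℤ) ∣ formEval l₀ n))) = 0 := by
  obtain ⟨-, -, hd₀M⟩ := SelbergBox.mem_box₀.1 hd₀
  obtain ⟨-, -, he₀M⟩ := SelbergBox.mem_box₀.1 he₀
  rcases cross_coprime_or_empty_plus hadm hd he l₀ hΔ hd₀M he₀M with hP | hE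
  · exact absurd hP hcross
  · exact Finset.card_eq_zero.2 (Finset.filter_eq_empty_iff.2 fun n _ hn =>
      hE n ⟨⟨hn.1.2.1, hn.1.2.2⟩, hn.2.2⟩)

/-- **Both cases in one line**: with `c = 1` if the coupled tuple is cross-coprime and `c = 0` otherwise,
`|#{n : …} − c · #𝒜(X) φ_{ω⁺}(W)/(W [d₀,e₀] ∏[d_i,e_i])| ≤ φ_{ω⁺}(W)`.
[cite: Maynard2016DenseClusters, proof of Prop. 9.4 p. 26, (9.1) p. 19] -/
theorem abs_card_dyadZ_pairPlus_sub_ite_le (X : ℝ) {L : Fin k → ℤ × ℤ} (hadm : FormsAdmissible L)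
    {B : ℕ} {R : ℝ} {d e : Fin k → ℕ} (hd : d ∈ dkBox L B R) (he : e ∈ dkBox L B R) (l₀ : ℤ × ℤ)
    {M : ℕ} (hWM : wCut k B ∣ M) (hΔ : discDelta L l₀ ∣ M) {R₀ : ℝ} {d₀ e₀ : ℕ}
    (hd₀ : d₀ ∈ SelbergBox.box₀ M R₀) (he₀ : e₀ ∈ SelbergBox.box₀ M R₀) :
    |(#((dyadZ X).filter fun n : ℤ =>
          ((∀ i, Int.gcd (formEval (L i) n) (wCut k B) = 1) ∧
            (∀ i, ((d i : ℕ) : ℤ) ∣ formEval (L i) n) ∧ ∀ i, ((e i : ℕ) : ℤ) ∣ formEval (L i) n) ∧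
          (Int.gcd (formEval l₀ n) (wCut k B) = 1 ∧
            (((d₀ : ℕ) : ℤ) ∣ formEval l₀ n ∧ ((e₀ : ℕ) : ℤ) ∣ formEval l₀ n))) : ℝ) -
        (if (∀ i j, i ≠ j → (d i * e i).Coprime (d j * e j)) ∧ ∀ i, (d₀ * e₀).Coprime (d i * e i)
          then (#(dyadZ X) : ℝ) * phiOmega (Fin.cons l₀ L : Fin (k + 1) → ℤ × ℤ) (wCut k B) /
            ((wCut k B : ℝ) * (((Nat.lcm d₀ e₀ : ℕ) : ℝ) * ∏ ι, ((Nat.lcm (d ι) (e ι) : ℕ) : ℝ)))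
          else 0)|
      ≤ phiOmega (Fin.cons l₀ L : Fin (k + 1) → ℤ × ℤ) (wCut k B) := by
  have hφ : 0 ≤ phiOmega (Fin.cons l₀ L : Fin (k + 1) → ℤ × ℤ) (wCut k B) := by
    rw [← cast_prod_sub_omegaL]; positivity
  split_ifs with hc
  · exact abs_card_dyadZ_pairPlus_sub_le X hadm hd he l₀ hWM hΔ hd₀ he₀
      (fun i j hij => hc.1 i j hij) hc.2
  · have hc' : ¬ ((Pairwise fun i j => (d i * e i).Coprime (d j * e j)) ∧
        ∀ i, (d₀ * e₀).Coprime (d i * e i)) := fun h => hc ⟨fun i j hij => h.1 hij, h.2⟩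
    rw [card_pairPlus_filter_eq_zero (dyadZ X) hadm hd he l₀ hΔ hd₀ he₀ hc']
    simpa using hφ

end Literature.NumberTheory.Sieve.FGKMT2018
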